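import Summits.QuantumFields.YangMills.Theorems.BalabanUVNodesK1R9CruxIffAECurrency
import Literature.MathematicalPhysics.QuantumFieldTheory.Balaban1983to89.B12NodeKnitIndAPlug

/-!
# BalabanUVNodes ∕ N13 — [III] Cor. 3 (2.50) AT LEVEL `0` FROM THE CRUX's OWN ROW (iv) (the run-wise partial-sum floor of β): the β-box letter `BetaLowerH (−β′) γ β_θ` REMOVED from the
# level-0 face of (B); K1⁹ BY NAME from «Thm 1 + `Efl ≡ 0` + `logz ≡ 0` + (2.50) `dV_{k+1}`-a.e. at levels `k+1 ≤ K` + `RunRowsCont13 F θ`» — nothing else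

Cell `pub-ymgap` (HUMAN RULING D-0062 Track A ∕ D-0149 width), WIDTH SEAT `pub-ymgap-dag-n13-w1` (gen 5, CLAIM-7), key K1⁹ `StabilityBRunRowsAtRecordR13SepCoPHV` = stmt-QuantumFields-27364
(`route-QuantumFields-BalabanUVNodes` rev 28∕29, commit 5c92291ad69b; `--kind proof --supports … --as helper`; count-neutral).  OWN LINEAGE: dag-n13-w1 g0's p590719
`…N13UV01LevelZeroAtRecord13SignFree` ((2.50) at `k = 0` for EVERY field under `Efl = logz = 0`, `γ ≤ 1` and the NODE-O letter `BetaLowerH (−β′) γ β_θ` — β bounded below on the WHOLE γ-box —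
used ONLY to obtain `g_j⁻² ≤ g₀⁻² + j·β′` along the run, i.e. to keep the energy normalisation `−E(P) = Σ_j (d(𝔤)·log g_j⁻¹ − log σ₀)·|T^{(j)*}|` from blowing up when the couplings collapse),
g5's p623627 ∕ p627940 (the K1⁹ template `…K1R9CruxIffAECurrency.stabilityBRunRowsAtRecordR13SepCoPHV_of_aeSuccRoad`, which still displayed that letter).

THE POINT (substantive, elementary).  The deciding crux K1⁹ ALREADY CARRIES, inside its rows conjunct `RunRowsCont13 F θ`, row (iv): the RUN-WISE PARTIAL-SUM FLOOR
«`∀ n gs, RGEqH n β_θ gs → Step.InInterval γ₀ n gs → ∀ k ≤ n, −M ≤ Σ_{j ∈ [k,n)} β_θ j (g_0,…,g_j)`» ([I] Thm 2 p.259's minimal input, the tree's `BetaPartialSumsLowerH` read along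
(0.20)-solutions).  The record's run `P` IS the forward-generated history `gOfRecord₁₃ θ P = genSeq β_θ P.g₀` of (0.20) (`rfl`), it solves `RGEqH` on every horizon `j ≤ K` once it stays in a
window (`B12NodeKnitIndAPlug.rgEqH_genSeq_of_inInterval`), and (0.20) telescopes (`FlowStep.inv_sq_telescopeH`): `g₀⁻² = g_j⁻² + Σ_{i<j} β_i`.  So row (iv) at `(n, k) := (j, 0)` gives
`g_j⁻² ≤ g₀⁻² + M` for every `j ≤ K` of every γ-windowed run with `γ ≤ γ₀` (§1) — a UNIFORM-in-`j` version of p590719's `g_j⁻² ≤ g₀⁻² + j·β′`, from a hypothesis the crux already asks.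
Then p590719's logarithmic step gives `log g_j⁻¹ ≤ log g₀⁻¹ + M∕2`, hence `−E(P) ≤ 4·(d(𝔤)·(log g₀⁻¹ + M∕2) + max(−log σ₀, 0))·|T⁰|` (§2) and (2.50) at level 0 with
`em₀(g) = 4·max(log σ₀,0) + 12·g⁻²`, `ep₀″(g) = 4·(d(𝔤)·(log g⁻¹ + M∕2) + max(−log σ₀,0))` (§3), NO β-box letter of any sign.

CONTENTS.  §1 flow arithmetic (general `N`): `inv_sq_le_inv_sq_zero_add_of_rgEqH_of_partialSumFloor`, `partialSumFloor_nonneg_of_inInterval`, ★ `inv_sq_gOfRecord₁₃_le_of_inInterval_of_runPartialSumFloor`.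
§2 ★ `neg_EOfRecord₁₃_le_of_inInterval_of_invSqFloor`.  §3 ★★ `uv_zero_densOfRecord₁₃_of_Efl_logz_of_inInterval_of_invSqFloor` (both sides, engines' currency), `uvIneq_zero_datumOfRecord₁₃CoPH_…_of_invSqFloor`
([B16]'s carrier at the construction of record, dag-n24-c's `uvIneq_at_record₁₃CoPH_iff`), ★★ `uvIneq_zero_datumOfRecord₁₃CoPH_…_of_runPartialSumFloor` (row (iv) in the item's inline spelling
as the hypothesis).  §4 (`N = 2`) ★★ `exists_revision₁₃_endStatementBPrinted_of_aeSucc_of_runPartialSumFloor` (the K1⁹ (B)-slot from Thm 1 + normalisation letters + row (iv) + (2.50) a.e.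
above level 0) and ★★★ `stabilityBRunRowsAtRecordR13SepCoPHV_of_aeSuccRoad_rows` — K1⁹ BY NAME ⟸ «`∀ F, Inhabited13 F → ∃ θ h`, (unity ∧ slots) ∧ Admissible ∧ Thm1Printed (record) ∧
`θ.Efl ≡ 0` ∧ `θ.logz ≡ 0` ∧ `∃ γ > 0, ∃ em ep`, (2.50) `dV_{k+1}`-a.e. at levels `k+1 ≤ K` on γ-windowed runs ∧ `RunRowsCont13 F θ`»: p627940's template MINUS `γ ≤ 1`, `0 ≤ β′`,
`BetaLowerH (−β′) γ β_θ` (the window is shrunk to `min γ (min γ₀ 1)` inside the proof; the a.e. rows restrict to narrower windows).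

HONEST FRAMING.  Elementary flow arithmetic over the lineage's level-0 estimate; nothing of Bałaban's Cor. 3 above level 0 asserted; every displayed hypothesis remains a hypothesis;
K1⁹ (deciding crux) NEITHER proved NOR refuted; N13 NOT discharged; no stub closed; counts unmoved (typed 28∕28 · discharged 5∕27 · A 5∕28); one finite `𝕋⁴_{L^K}` programme at fixed ε;
R4 closes the CONDITIONAL finite-𝕋⁴ rung `BalabanLadder.UV` only — the Yang–Mills mass gap (Clay) is NOT proved by any of this.  No `sorry`, `def`, `instance`, `notation`; standard axioms.
-/

noncomputable section

open scoped BigOperators ENNReal NNReal Matrix.Norms.L2Operator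

namespace Summit.QuantumFields.YangMills.BalabanUVNodes.N13UV01LevelZeroOfPartialSumFloorAtRecord13

open MeasureTheory
open Literature.MathematicalPhysics.QuantumFieldTheory.Balaban1983to89
open Literature.MathematicalPhysics.QuantumFieldTheory.Balaban1983to89.T4Continuum
open Literature.MathematicalPhysics.QuantumFieldTheory.Balaban1983to89.Node00
open Literature.MathematicalPhysics.QuantumFieldTheory.Balaban1983to89.FlowStepRuns (genFlow genSeq genSeq_zero)
open Literature.MathematicalPhysics.QuantumFieldTheory.Balaban1983to89.FlowStep (HBeta prefixOf RGEqH inv_sq_telescopeH)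
open Literature.MathematicalPhysics.QuantumFieldTheory.Balaban1983to89.B12NodeKnitIndAPlug (rgEqH_genSeq_of_inInterval)
open Literature.MathematicalPhysics.QuantumFieldTheory.Balaban1983to89.T4DatumAssembly.TowerReviseAE (uvIneq_mono_upper)
open Summit.QuantumFields.YangMills.BalabanUVNodes.N13UV01LevelZeroAtRecord13
  (uv_upper_zero_of_negE_le uv_lower_zero_of_E_le EOfRecord₁₃_le_of_inInterval EOfRecord₁₃_eq_sum_of_Efl_logz tstarCount_P_nonneg sum_tstarCount_P_range_le)
open Summit.QuantumFields.YangMills.BalabanUVNodes.N13UV01LevelZeroAtRecord13SignFree (log_inv_le_log_inv_add_of_inv_sq_le)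
open Summit.QuantumFields.YangMills.BalabanUVNodes.K1R9VersionSlotOfAEAtRecord (exists_revision₁₃_endStatementBPrinted_of_ae)
open Summit.QuantumFields.YangMills.BalabanUVNodes.K1R9SlotOfAESuccLevelZeroAtRecord (uvIneq_mono_lower chi_datumOfRecord₁₃SepCoPH_nonneg)
open Summit.QuantumFields.YangMills.Theorems.K1V6Defs (Inhabited13)
open Summit.QuantumFields.YangMills.Theorems.BalabanUVNodesK1R8RowsDefs (RunRowsCont13)
open Summit.QuantumFields.YangMills.Theorems.BalabanUVNodesK1R9WindowConjunctIdle (stabilityBRunRowsAtRecordR13SepCoPHV_of_windowFree)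
open Summit.QuantumFields.YangMills.Theses.BalabanUVNodes (StabilityBRunRowsAtRecordR13SepCoPHV)

variable {F : T4Family} {N : ℕ} [NeZero N]

/-! ## §1 Flow arithmetic: the partial-sum floor of row (iv) along a (0.20)-solution bounds `g_n⁻²` by `g₀⁻² + M` -/

omit [NeZero N] in
/-- **`g_n⁻² ≤ g₀⁻² + M` FROM (0.20) AND THE PARTIAL-SUM FLOOR AT `k = 0`**: (0.20) telescopes to `g₀⁻² = g_n⁻² + Σ_{j<n} β_j(g_0,…,g_j)` (`FlowStep.inv_sq_telescopeH`), so `−M ≤ Σ_{j<n} β_j`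
gives the claim.  Elementary. [cite: Balaban1987RG1, (0.20) p.256, Thm 2 p.259] -/
theorem inv_sq_le_inv_sq_zero_add_of_rgEqH_of_partialSumFloor {β : HBeta} {g : ℕ → ℝ} {n : ℕ} (hrg : RGEqH n β g) {M : ℝ}
    (hfl : -M ≤ ∑ j ∈ Finset.Ico 0 n, β j (prefixOf g j)) : (g n ^ 2)⁻¹ ≤ (g 0 ^ 2)⁻¹ + M := by
  have ht := inv_sq_telescopeH hrg (Nat.zero_le n) le_rfl
  rw [one_div, one_div] at ht
  linarith

/-- **THE FLOOR CONSTANT IS NON-NEGATIVE ON ANY WINDOWED RUN** (row (iv) at the empty range `n = k = 0`, along the record's run, which lies in `]0, γ] ⊆ ]0, γ₀]` at level 0). [folklore] -/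
theorem partialSumFloor_nonneg_of_inInterval (θ : Stage13Params F N) (P : B12.RunParams) {γ γ₀ M : ℝ} (hγ₀ : γ ≤ γ₀)
    (hps : ∀ (n : ℕ) (gs : ℕ → ℝ), RGEqH n (betaOfRecord₁₃ F N θ) gs → Step.InInterval γ₀ n gs →
      ∀ k, k ≤ n → -M ≤ ∑ j ∈ Finset.Ico k n, betaOfRecord₁₃ F N θ j (prefixOf gs j))
    (hI : (genFlow (betaOfRecord₁₃ F N θ) P.g0).InInterval γ P.K) : 0 ≤ M := by
  have hrg : RGEqH 0 (betaOfRecord₁₃ F N θ) (genSeq (betaOfRecord₁₃ F N θ) P.g0) := fun k hk => absurd hk (Nat.not_lt_zero k)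
  have hI0 : Step.InInterval γ₀ 0 (genSeq (betaOfRecord₁₃ F N θ) P.g0) :=
    fun i hi => ⟨(hI i (hi.trans (Nat.zero_le _))).1, (hI i (hi.trans (Nat.zero_le _))).2.trans hγ₀⟩
  have h := hps 0 _ hrg hI0 0 le_rfl
  rw [Finset.Ico_self, Finset.sum_empty] at h
  linarith

/-- ★ **ALONG THE RECORD's RUN, ROW (iv) GIVES `g_j⁻² ≤ g₀⁻² + M` FOR EVERY `j ≤ K`** (γ-windowed run, `γ ≤ γ₀`): the run `gOfRecord₁₃ θ P = genSeq β_θ P.g₀` solves (0.20) on every horizon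
`j ≤ K` while in the window (`B12NodeKnitIndAPlug.rgEqH_genSeq_of_inInterval`), lies in `]0, γ₀]` up to `j`, and the floor at `(n, k) := (j, 0)` applies (§1).  The UNIFORM-in-`j`
replacement of p590719's `g_j⁻² ≤ g₀⁻² + j·β′` (which read `β ≥ −β′` on the whole box). [cite: Balaban1987RG1, (0.18)–(0.20) pp.255–256, Thm 2 p.259, §1 pp.263–264] -/
theorem inv_sq_gOfRecord₁₃_le_of_inInterval_of_runPartialSumFloor (θ : Stage13Params F N) (P : B12.RunParams) {γ γ₀ M : ℝ} (hγ₀ : γ ≤ γ₀)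
    (hps : ∀ (n : ℕ) (gs : ℕ → ℝ), RGEqH n (betaOfRecord₁₃ F N θ) gs → Step.InInterval γ₀ n gs →
      ∀ k, k ≤ n → -M ≤ ∑ j ∈ Finset.Ico k n, betaOfRecord₁₃ F N θ j (prefixOf gs j))
    (hI : (genFlow (betaOfRecord₁₃ F N θ) P.g0).InInterval γ P.K) :
    ∀ j, j ≤ P.K → (gOfRecord₁₃ F N θ P j ^ 2)⁻¹ ≤ (P.g0 ^ 2)⁻¹ + M := by
  intro j hj
  have hrg : RGEqH j (betaOfRecord₁₃ F N θ) (genSeq (betaOfRecord₁₃ F N θ) P.g0) :=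
    rgEqH_genSeq_of_inInterval (betaOfRecord₁₃ F N θ) P hI hj
  have hIj : Step.InInterval γ₀ j (genSeq (betaOfRecord₁₃ F N θ) P.g0) :=
    fun i hi => ⟨(hI i (hi.trans hj)).1, (hI i (hi.trans hj)).2.trans hγ₀⟩
  have h := inv_sq_le_inv_sq_zero_add_of_rgEqH_of_partialSumFloor hrg (hps j _ hrg hIj 0 (Nat.zero_le j))
  rw [genSeq_zero] at h
  exact h

/-! ## §2 The energy normalisation along a windowed run under the coupling floor -/

/-- ★ **`−E(P) ≤ 4·(d(𝔤)·(log g₀⁻¹ + M∕2) + max(−log σ₀, 0))·|T^{(0)}|` ALONG A γ-WINDOWED RUN (`γ ≤ 1`) WHOSE COUPLINGS OBEY `g_j⁻² ≤ g₀⁻² + M` (`0 ≤ M`)**, at `Efl = logz = 0`: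
p590719's `neg_EOfRecord₁₃_le_of_inInterval_of_betaLowerH_neg` with the per-level `j·β′∕2` replaced by the uniform `M∕2` (`log g_j⁻¹ ≤ log g₀⁻¹ + M∕2` by its logarithmic step,
`Σ_{j<K} |T^{(j)*}| ≤ 4|T^{(0)}|`).  No β-box letter. [cite: Balaban1988Convergent, Thm 1 p.262, (1.15) p.249; Balaban1987RG1, (0.20) p.256 (elementary over the displayed floor)] -/
theorem neg_EOfRecord₁₃_le_of_inInterval_of_invSqFloor (θ : Stage13Params F N) (P : B12.RunParams)
    (hEfl : ∀ j, θ.Efl P j = 0) (hlogz : ∀ j, θ.logz P j = 0) {γ M : ℝ} (hγ : γ ≤ 1) (hM : 0 ≤ M)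
    (hfl : ∀ j, j ≤ P.K → (gOfRecord₁₃ F N θ P j ^ 2)⁻¹ ≤ (P.g0 ^ 2)⁻¹ + M)
    (hI : (genFlow (betaOfRecord₁₃ F N θ) P.g0).InInterval γ P.K) :
    -(EOfRecord₁₃ F N θ P) ≤ 4 * ((dimSU N : ℕ) * (Real.log P.g0⁻¹ + M / 2) + max (-θ.ν.logσ₀) 0) * (Fintype.card (Site (F.P P.K) 0) : ℝ) := by
  rw [EOfRecord₁₃_eq_sum_of_Efl_logz θ P hEfl hlogz, ← Finset.sum_neg_distrib]
  have hg0 := hI 0 (Nat.zero_le _)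
  have hg0eq : gOfRecord₁₃ F N θ P 0 = P.g0 := genSeq_zero _ _
  have hg0pos : 0 < P.g0 := hg0eq ▸ hg0.1
  have hg0le : P.g0 ≤ 1 := hg0eq ▸ (hg0.2.trans hγ)
  have hlog0 : 0 ≤ Real.log P.g0⁻¹ := Real.log_nonneg (one_le_inv_iff₀.mpr ⟨hg0pos, hg0le⟩)
  have hd : (0 : ℝ) ≤ (dimSU N : ℕ) := Nat.cast_nonneg _
  have hM2 : 0 ≤ M / 2 := by linarith
  have hstep : ∀ j ∈ Finset.range P.K,
      -((Real.log (gOfRecord₁₃ F N θ P j) * (dimSU N : ℕ) + θ.ν.logσ₀) * tstarCount (F.P P.K) j)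
        ≤ ((dimSU N : ℕ) * (Real.log P.g0⁻¹ + M / 2) + max (-θ.ν.logσ₀) 0) * tstarCount (F.P P.K) j := by
    intro j hj
    have hjK : j < P.K := Finset.mem_range.mp hj
    have hT : 0 ≤ tstarCount (F.P P.K) j := tstarCount_P_nonneg (by simp; omega)
    have hgj := hI j hjK.le
    have hlog : Real.log (gOfRecord₁₃ F N θ P j)⁻¹ ≤ Real.log P.g0⁻¹ + M / 2 := by
      refine log_inv_le_log_inv_add_of_inv_sq_le hgj.1 hg0pos hg0le hM ?_
      exact hfl j hjK.le
    have hlog' : -Real.log (gOfRecord₁₃ F N θ P j) ≤ Real.log P.g0⁻¹ + M / 2 := by rwa [Real.log_inv] at hlog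
    have h1 : -(Real.log (gOfRecord₁₃ F N θ P j) * (dimSU N : ℕ) + θ.ν.logσ₀)
        ≤ (dimSU N : ℕ) * (Real.log P.g0⁻¹ + M / 2) + max (-θ.ν.logσ₀) 0 := by
      have := mul_le_mul_of_nonneg_right hlog' hd
      linarith [le_max_left (-θ.ν.logσ₀) 0]
    rw [← neg_mul]
    exact mul_le_mul_of_nonneg_right h1 hT
  refine (Finset.sum_le_sum hstep).trans ?_
  rw [← Finset.mul_sum]
  have hm : 0 ≤ (dimSU N : ℕ) * (Real.log P.g0⁻¹ + M / 2) + max (-θ.ν.logσ₀) 0 := by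
    have := mul_nonneg hd (add_nonneg hlog0 hM2)
    linarith [le_max_right (-θ.ν.logσ₀) 0]
  calc ((dimSU N : ℕ) * (Real.log P.g0⁻¹ + M / 2) + max (-θ.ν.logσ₀) 0) * ∑ j ∈ Finset.range P.K, tstarCount (F.P P.K) j
      ≤ ((dimSU N : ℕ) * (Real.log P.g0⁻¹ + M / 2) + max (-θ.ν.logσ₀) 0) * (4 * (Fintype.card (Site (F.P P.K) 0) : ℝ)) :=
        mul_le_mul_of_nonneg_left (sum_tstarCount_P_range_le P.K P.K) hm
    _ = 4 * ((dimSU N : ℕ) * (Real.log P.g0⁻¹ + M / 2) + max (-θ.ν.logσ₀) 0) * (Fintype.card (Site (F.P P.K) 0) : ℝ) := by ring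

/-! ## §3 ★★ (2.50) at level `0` under the coupling floor ∕ under row (iv): both sides, engines' currency and [B16]'s carrier -/

/-- **★★ THE LEVEL-`0` CONJUNCT OF N13's (UV₁₃) ROW, BOTH SIDES, UNDER THE COUPLING FLOOR `g_j⁻² ≤ g₀⁻² + M`** (`0 ≤ M`, `γ ≤ 1`, `Efl = logz = 0`):
`χβ₀·exp(−g₀⁻²·A^η₀ − em₀(g₀)·|T⁰|) ≤ ρ₀ ≤ exp(ep₀″(g₀)·|T⁰|)` with `em₀(g) = 4·max(log σ₀,0) + 12·g⁻²` (p590719's, floor-free) and `ep₀″(g) = 4·(d(𝔤)·(log g⁻¹ + M∕2) + max(−log σ₀,0))`.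
[cite: Balaban1989LargeFieldII, (0.1) pp.355–356; Balaban1988Convergent, Cor. 3 (2.50) p.264, Thm 1 p.262, (1.15) p.249; Balaban1987RG1, (0.20) p.256] -/
theorem uv_zero_densOfRecord₁₃_of_Efl_logz_of_inInterval_of_invSqFloor (θ : Stage13Params F N) (P : B12.RunParams)
    (hEfl : ∀ j, θ.Efl P j = 0) (hlogz : ∀ j, θ.logz P j = 0) {γ M : ℝ} (hγ : γ ≤ 1) (hM : 0 ≤ M)
    (hfl : ∀ j, j ≤ P.K → (gOfRecord₁₃ F N θ P j ^ 2)⁻¹ ≤ (P.g0 ^ 2)⁻¹ + M)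
    (hI : (genFlow (betaOfRecord₁₃ F N θ) P.g0).InInterval γ P.K) (U : GaugeField (F.P P.K) 0 (SU N)) :
    chiβOfRecord₁₃ F N θ P.K (gOfRecord₁₃ F N θ P) 0 U *
          Real.exp (-(1 / (gOfRecord₁₃ F N θ P 0)) ^ 2 * wilsonBGOfRecord F N θ.εbg P 0 U
            - (4 * max θ.ν.logσ₀ 0 + 12 * (1 / gOfRecord₁₃ F N θ P 0) ^ 2) * (Fintype.card (Site (F.P P.K) 0) : ℝ)) ≤ densOfRecord₁₃ F N θ P 0 U ∧
      densOfRecord₁₃ F N θ P 0 U ≤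
        Real.exp (4 * ((dimSU N : ℕ) * (Real.log (gOfRecord₁₃ F N θ P 0)⁻¹ + M / 2) + max (-θ.ν.logσ₀) 0) * (Fintype.card (Site (F.P P.K) 0) : ℝ)) := by
  have hg0 : gOfRecord₁₃ F N θ P 0 = P.g0 := genSeq_zero _ _
  refine ⟨?_, ?_⟩
  · have h := uv_lower_zero_of_E_le θ P (EOfRecord₁₃_le_of_inInterval θ P hEfl hlogz hγ hI) U
    rw [hg0] at h ⊢
    exact h
  · rw [hg0]
    exact uv_upper_zero_of_negE_le θ P (neg_EOfRecord₁₃_le_of_inInterval_of_invSqFloor θ P hEfl hlogz hγ hM hfl hI) U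

/-- **(0.1) ∕ (2.50) AT LEVEL `0` AT THE CONSTRUCTION OF RECORD UNDER THE COUPLING FLOOR**, in [B16]'s carrier `B16.UVIneq` with `E₋ = em₀(g₀)`, `E₊ = ep₀″(g₀)` — through dag-n24-c's
`B16NodeKnitRecord13CoPH.uvIneq_at_record₁₃CoPH_iff`. [cite: Balaban1989LargeFieldII, (0.1) p.356; Balaban1988Convergent, (2.50) p.264] -/
theorem uvIneq_zero_datumOfRecord₁₃CoPH_of_Efl_logz_of_inInterval_of_invSqFloor (θ : Stage13HParams F N) (h : θ.Provisos₁₃CoPH F N) (P : B12.RunParams)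
    (hEfl : ∀ j, θ.Efl P j = 0) (hlogz : ∀ j, θ.logz P j = 0) {γ M : ℝ} (hγ : γ ≤ 1) (hM : 0 ≤ M)
    (hfl : ∀ j, j ≤ P.K → (gOfRecord₁₃ F N θ.toStage13Params P j ^ 2)⁻¹ ≤ (P.g0 ^ 2)⁻¹ + M)
    (hI : (genFlow (betaOfRecord₁₃ F N θ.toStage13Params) P.g0).InInterval γ P.K) (V : GaugeField (F.P P.K) 0 (SU N)) :
    B16.UVIneq ((datumOfRecord₁₃CoPH F N θ h).C P) 0 V
      (4 * max θ.ν.logσ₀ 0 + 12 * (1 / gOfRecord₁₃ F N θ.toStage13Params P 0) ^ 2)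
      (4 * ((dimSU N : ℕ) * (Real.log (gOfRecord₁₃ F N θ.toStage13Params P 0)⁻¹ + M / 2) + max (-θ.ν.logσ₀) 0)) := by
  have h0 := uv_zero_densOfRecord₁₃_of_Efl_logz_of_inInterval_of_invSqFloor θ.toStage13Params P hEfl hlogz hγ hM hfl hI V
  refine (B16NodeKnitRecord13CoPH.uvIneq_at_record₁₃CoPH_iff F N θ h P 0 V _ _).mpr ⟨?_, h0.2⟩
  convert h0.1 using 3
  ring

/-- **★★ (2.50) AT LEVEL `0` AT THE CONSTRUCTION OF RECORD FROM ROW (iv) IN THE ITEM's INLINE SPELLING** — on every γ-windowed run with `γ ≤ 1`, `γ ≤ γ₀`, at `Efl = logz = 0`, given the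
run-wise partial-sum floor of `β_θ := betaOfRecord₁₃ θ` at level `γ₀` with constant `M` (K1⁹'s row (iv) verbatim): (2.50) at `k = 0` for EVERY field with `E₋ = em₀(g₀)`, `E₊ = ep₀″(g₀)`.
NO β-box letter. [cite: Balaban1989LargeFieldII, (0.1) p.356; Balaban1988Convergent, (2.50) p.264, Thm 1 p.262; Balaban1987RG1, (0.20) p.256, Thm 2 p.259] -/
theorem uvIneq_zero_datumOfRecord₁₃CoPH_of_Efl_logz_of_inInterval_of_runPartialSumFloor (θ : Stage13HParams F N) (h : θ.Provisos₁₃CoPH F N) (P : B12.RunParams)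
    (hEfl : ∀ j, θ.Efl P j = 0) (hlogz : ∀ j, θ.logz P j = 0) {γ γ₀ M : ℝ} (hγ : γ ≤ 1) (hγ₀ : γ ≤ γ₀)
    (hps : ∀ (n : ℕ) (gs : ℕ → ℝ), RGEqH n (betaOfRecord₁₃ F N θ.toStage13Params) gs → Step.InInterval γ₀ n gs →
      ∀ k, k ≤ n → -M ≤ ∑ j ∈ Finset.Ico k n, betaOfRecord₁₃ F N θ.toStage13Params j (prefixOf gs j))
    (hI : (genFlow (betaOfRecord₁₃ F N θ.toStage13Params) P.g0).InInterval γ P.K) (V : GaugeField (F.P P.K) 0 (SU N)) :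
    B16.UVIneq ((datumOfRecord₁₃CoPH F N θ h).C P) 0 V
      (4 * max θ.ν.logσ₀ 0 + 12 * (1 / gOfRecord₁₃ F N θ.toStage13Params P 0) ^ 2)
      (4 * ((dimSU N : ℕ) * (Real.log (gOfRecord₁₃ F N θ.toStage13Params P 0)⁻¹ + M / 2) + max (-θ.ν.logσ₀) 0)) :=
  uvIneq_zero_datumOfRecord₁₃CoPH_of_Efl_logz_of_inInterval_of_invSqFloor θ h P hEfl hlogz hγ
    (partialSumFloor_nonneg_of_inInterval θ.toStage13Params P hγ₀ hps hI)
    (inv_sq_gOfRecord₁₃_le_of_inInterval_of_runPartialSumFloor θ.toStage13Params P hγ₀ hps hI) hI V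

/-! ## §4 (`N = 2`) The K1⁹ (B)-slot and the deciding crux BY NAME, without the β-box letter -/

/-- ★★ **THE K1⁹ (B)-SLOT FROM THEOREM 1's CLAUSE + `Efl ≡ 0` + `logz ≡ 0` + ROW (iv) + (2.50) `dV_{k+1}`-A.E. AT LEVELS `k+1 ≤ K`** (`0 < γ ≤ 1`, `γ ≤ γ₀`): p623627's
`exists_revision₁₃_endStatementBPrinted_of_aeSucc_of_betaLowerH` with the β-box letter replaced by the run-wise partial-sum floor (§3), exponent pairs merged by `max` (monotonicity of
(2.50), `χ ≥ 0`), then this seat's route-free junction `exists_revision₁₃_endStatementBPrinted_of_ae` (p622796: the (δ) surgery p620313 + DEF-1's adapter p620607).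
[cite: Balaban1989LargeFieldII, Thm 1 + (0.1) pp.355–356; Balaban1988Convergent, (2.18) p.257, Cor. 3 (2.50) p.264; Balaban1987RG1, (0.20) p.256, Thm 2 p.259] -/
theorem exists_revision₁₃_endStatementBPrinted_of_aeSucc_of_runPartialSumFloor {F : T4Family} (θ : Stage13HParams F 2) (h : θ.Provisos₁₃SepCoPH F 2)
    (hEfl : ∀ (P : B12.RunParams) (j : ℕ), θ.Efl P j = 0) (hlogz : ∀ (P : B12.RunParams) (j : ℕ), θ.logz P j = 0)
    {γ γ₀ M : ℝ} (hγ : 0 < γ) (hγ1 : γ ≤ 1) (hγ₀ : γ ≤ γ₀)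
    (hps : ∀ (n : ℕ) (gs : ℕ → ℝ), RGEqH n (betaOfRecord₁₃ F 2 θ.toStage13Params) gs → Step.InInterval γ₀ n gs →
      ∀ k, k ≤ n → -M ≤ ∑ j ∈ Finset.Ico k n, betaOfRecord₁₃ F 2 θ.toStage13Params j (prefixOf gs j))
    (h1 : B16.Thm1Printed (datumOfRecord₁₃SepCoPH F 2 θ h).C) (em ep : ℝ → ℝ)
    (hae : ∀ p : B12.RunParams, ((datumOfRecord₁₃SepCoPH F 2 θ h).C p).flow.InInterval γ p.K → ∀ k : ℕ, k + 1 ≤ p.K →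
      ∀ᵐ V ∂fieldMeasure (F.P p.K) (k + 1) (SU 2),
        B16.UVIneq ((datumOfRecord₁₃SepCoPH F 2 θ h).C p) (k + 1) V (em (((datumOfRecord₁₃SepCoPH F 2 θ h).C p).flow.g (k + 1)))
          (ep (((datumOfRecord₁₃SepCoPH F 2 θ h).C p).flow.g (k + 1)))) :
    ∃ v : Revision₁₃ F 2 θ h, B16.EndStatementBPrinted (datumOfRecord₁₃SepCoPHV F 2 θ h v).C := by
  -- the level-0 exponents (floor version) and the merged pair
  let em₀ : ℝ → ℝ := fun g => 4 * max θ.ν.logσ₀ 0 + 12 * (1 / g) ^ 2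
  let ep₀ : ℝ → ℝ := fun g => 4 * ((dimSU 2 : ℕ) * (Real.log g⁻¹ + M / 2) + max (-θ.ν.logσ₀) 0)
  let em' : ℝ → ℝ := fun g => max (em g) (em₀ g)
  let ep' : ℝ → ℝ := fun g => max (ep g) (ep₀ g)
  refine exists_revision₁₃_endStatementBPrinted_of_ae θ h hγ em' ep' h1 ?_ ?_
  · -- level 0 at EVERY field from row (iv), then enlarge both exponents
    intro p hp V
    have h0 := uvIneq_zero_datumOfRecord₁₃CoPH_of_Efl_logz_of_inInterval_of_runPartialSumFloor θ h.toCore p (hEfl p) (hlogz p) hγ1 hγ₀ hps hp V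
    have h0' : B16.UVIneq ((datumOfRecord₁₃SepCoPH F 2 θ h).C p) 0 V (em₀ (((datumOfRecord₁₃SepCoPH F 2 θ h).C p).flow.g 0))
        (ep₀ (((datumOfRecord₁₃SepCoPH F 2 θ h).C p).flow.g 0)) := h0
    exact uvIneq_mono_upper (uvIneq_mono_lower (chi_datumOfRecord₁₃SepCoPH_nonneg θ h p 0 V) h0' (le_max_right _ _)) (le_max_right _ _)
  · -- levels ≥ 1 a.e.: enlarge both exponents inside the a.e. statement
    intro p hp k hk
    filter_upwards [hae p hp k hk] with V hV
    exact uvIneq_mono_upper (uvIneq_mono_lower (chi_datumOfRecord₁₃SepCoPH_nonneg θ h p (k + 1) V) hV (le_max_left _ _)) (le_max_left _ _)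

/-- ★★★ **THE DECIDING CRUX BY NAME FROM «THEOREM 1 + NORMALISATION LETTERS + (2.50) A.E. ABOVE LEVEL 0 + THE ROWS» — NO β-BOX LETTER.**  K1⁹ `…Theses.BalabanUVNodes.StabilityBRunRowsAtRecordR13SepCoPHV`
(stmt-QuantumFields-27364) follows from: at ONE witness `(θ, h)` per family with an admissible unity tuple — (unity ∧ slots), admissibility, [II] Theorem 1's clause at the record, `θ.Efl ≡ 0`,
`θ.logz ≡ 0`, SOME window `γ > 0` and exponents `em ep` with [III] Cor. 3 (2.50) `dV_{k+1}`-a.e. at levels `k+1 ≤ K` of every γ-windowed run (THE ONE OPEN ANALYTIC ENTRY of the (B)-face),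
and the rows `RunRowsCont13 F θ` THE CRUX ALREADY ASKS — whose row (iv) supplies the coupling floor level 0 needs (§1–§3) and whose row (i) supplies the window conjunct
(`…K1R9WindowConjunctIdle`).  Inside the proof the window is shrunk to `min γ (min γ₀ 1)` (the a.e. rows restrict to narrower windows).  p627940's `…_of_aeSuccRoad` MINUS the letters
`γ ≤ 1`, `0 ≤ β′`, `BetaLowerH (−β′) γ β_θ`.  CONDITIONAL on the displayed hypotheses; K1⁹ NOT closed here; nothing of Bałaban's Cor. 3 above level 0 asserted.
[cite: Balaban1989LargeFieldII, Thm 1 + (0.1) pp.355–356; Balaban1988Convergent, (2.18) p.257, Cor. 3 (2.50) p.264; Balaban1987RG1, Thm 2 p.259, Thm 3 p.264, (5.10) p.293, §1 pp.263–264] -/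
theorem stabilityBRunRowsAtRecordR13SepCoPHV_of_aeSuccRoad_rows
    (hroad : ∀ F : T4Family, Inhabited13 F → ∃ (θ : Stage13HParams F 2) (h : θ.Provisos₁₃SepCoPH F 2),
      (θ.ZhUnity F 2 ∧ θ.SlotsNondegenerate₁₃ F 2) ∧ θ.Admissible F 2 ∧
      B16.Thm1Printed (datumOfRecord₁₃SepCoPH F 2 θ h).C ∧
      (∀ (P : B12.RunParams) (j : ℕ), θ.Efl P j = 0) ∧ (∀ (P : B12.RunParams) (j : ℕ), θ.logz P j = 0) ∧
      (∃ γ : ℝ, 0 < γ ∧ ∃ em ep : ℝ → ℝ,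
        ∀ p : B12.RunParams, ((datumOfRecord₁₃SepCoPH F 2 θ h).C p).flow.InInterval γ p.K → ∀ k : ℕ, k + 1 ≤ p.K →
          ∀ᵐ V ∂fieldMeasure (F.P p.K) (k + 1) (SU 2),
            B16.UVIneq ((datumOfRecord₁₃SepCoPH F 2 θ h).C p) (k + 1) V (em (((datumOfRecord₁₃SepCoPH F 2 θ h).C p).flow.g (k + 1)))
              (ep (((datumOfRecord₁₃SepCoPH F 2 θ h).C p).flow.g (k + 1)))) ∧
      RunRowsCont13 F θ) :
    StabilityBRunRowsAtRecordR13SepCoPHV := by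
  refine stabilityBRunRowsAtRecordR13SepCoPHV_of_windowFree fun F hinh => ?_
  obtain ⟨θ, h, hU, hθ, h1, hEfl, hlogz, ⟨γ, hγ, em, ep, hae⟩, hrows⟩ := hroad F hinh
  have hrows' := hrows
  obtain ⟨b, r, γ₀, M, hγ₀, -, hps, -⟩ := hrows'
  -- shrink the window to `γ' := min γ (min γ₀ 1)`
  have hγ' : 0 < min γ (min γ₀ 1) := lt_min hγ (lt_min hγ₀ one_pos)
  have hγ'γ : min γ (min γ₀ 1) ≤ γ := min_le_left _ _
  have hγ'1 : min γ (min γ₀ 1) ≤ 1 := (min_le_right _ _).trans (min_le_right _ _)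
  have hγ'₀ : min γ (min γ₀ 1) ≤ γ₀ := (min_le_right _ _).trans (min_le_left _ _)
  have hae' : ∀ p : B12.RunParams, ((datumOfRecord₁₃SepCoPH F 2 θ h).C p).flow.InInterval (min γ (min γ₀ 1)) p.K → ∀ k : ℕ, k + 1 ≤ p.K →
      ∀ᵐ V ∂fieldMeasure (F.P p.K) (k + 1) (SU 2),
        B16.UVIneq ((datumOfRecord₁₃SepCoPH F 2 θ h).C p) (k + 1) V (em (((datumOfRecord₁₃SepCoPH F 2 θ h).C p).flow.g (k + 1)))
          (ep (((datumOfRecord₁₃SepCoPH F 2 θ h).C p).flow.g (k + 1))) :=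
    fun p hp k hk => hae p (fun i hi => ⟨(hp i hi).1, (hp i hi).2.trans hγ'γ⟩) k hk
  obtain ⟨v, hB⟩ := exists_revision₁₃_endStatementBPrinted_of_aeSucc_of_runPartialSumFloor θ h hEfl hlogz hγ' hγ'1 hγ'₀ hps h1 em ep hae'
  exact ⟨θ, h, v, hU, hθ, hB, hrows⟩

end Summit.QuantumFields.YangMills.BalabanUVNodes.N13UV01LevelZeroOfPartialSumFloorAtRecord13
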